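import Literature.Probability.RandomPlanarGeometry.StationaryAngleOneSided
import Literature.Probability.RandomPlanarGeometry.StationaryAngleInvariantMeasure
import Literature.Probability.RandomPlanarGeometry.StationaryAngleFiltration
import HarnessLib

/-!
# Existence of the stationary SLE_κ(0) angle law (`0 < κ ≤ 4`)

Topic `Probability/RandomPlanarGeometry`; proved theorems only (no definition, no named fact). The existence half of Miller–Sheffield (2013), Prop. 2.1 in the reduced
case `ρ = 0`, `0 < κ ≤ 4` (to which the non-hitting regime `κ ≤ 2(ρ+2)` reduces by time scaling,
`IsStationaryAngleLaw.exists_unique_of_rho_zero`): **there is a probability measure `P` on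
two-sided paths `C(ℝ, ℝ)` with `IsStationaryAngleLaw κ 0 P`** (`exists_isStationaryAngleLaw_rho_zero`).

Construction (`StationaryAngleInvariantMeasure`, `StationaryAngleOneSided`,
`Process.TwoSidedExtension`): the invariant probability measure `μ` of the SLE_κ radial Bessel
kernels on `(0, 2π)` (Krylov–Bogoliubov) gives the shift-invariant law `flowLaw κ μ` of the
one-sided flow `Y` started from `μ`; its two-sided extension `P` (Kolmogorov) is shift invariant
and its paths frozen before `-N` are, in law, the paths of `Y` started at time `-N`
(`P ∘ (clampPath N)⁻¹ = flowLaw κ μ ∘ (extendPath N)⁻¹`). The clauses of `IsStationaryAngleLaw`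
are then read off (`isStationaryAngleLaw_of_clamp`, which uses only the clamp identities and shift
invariance — it is reused by the uniqueness half):

* paths in `(0, 2π)` at all times: every path of the flow law is (`ae_flowLaw_forall_mem_Ioo`);
* the martingale-problem clause `E[N^f_{s,t} | ℱ_s] = 0`: by uniqueness of the conditional
  expectation it is the vanishing of `∫_A N^f_{s,t} dP` over `A ∈ ℱ_s = σ(x_u, u ≤ s)`; by Dynkin's
  π-λ theorem (`MeasurableSpace.induction_on_inter` on the cylinder π-system of `ℱ_s`) it suffices
  to treat finite-dimensional cylinders `A = ⋂_{j ∈ F} {x_j ∈ B_j}`, `j ≤ s`; such an integrand is a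
  function of the path clamped at a level `-N₀ ≤ min F`, hence an integral against the flow law of
  a past cylinder functional times the increment, which vanishes
  (`integral_prod_indicator_mul_angleIncrement_flowLaw_eq_zero`: generator identity + Markov
  structure of the flow).

## References

* J. Miller, S. Sheffield, *Imaginary geometry IV*, PTRF 169 (2017), arXiv:1302.4738, §2.1.2,
  Prop. 2.1. [MillerSheffield2013]
* I. Karatzas, S. Shreve, *Brownian Motion and Stochastic Calculus* (1988), Ch. 5 §4.B
  (martingale problem). [KaratzasShreve1988]
* O. Kallenberg, *Foundations of Modern Probability* (2002), Thm 6.16, Ch. 10. [Kallenberg2002]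
-/

noncomputable section

open MeasureTheory ProbabilityTheory Filter Topology Set
open scoped NNReal ENNReal

namespace Literature.Probability.RandomPlanarGeometry

open scoped PathBorel
open Literature.Probability.Process RadialLoewner

variable {κ : ℝ≥0}

/-! ### Path operations: measurability and the two names of the shift -/

section PathOps

/-- The extension of one-sided paths to two-sided ones is measurable. [folklore] -/
theorem measurable_extendPath (N : ℕ) : Measurable (extendPath N) := (continuous_extendPath N).measurable

/-- The two time shifts of the tree agree: `timeShift s = twoShift s`. [folklore] -/
theorem timeShift_eq_twoShift (s : ℝ) : (timeShift s : C(ℝ, ℝ) → C(ℝ, ℝ)) = twoShift s := by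
  funext x; ext t; simp

/-- The martingale-problem increment only sees the path on `[s, t]`: it is unchanged by clamping
at a level `-N ≤ s`. [folklore] -/
theorem angleIncrement_clampPath {ρ : ℝ} (f : ℝ → ℝ) {N : ℕ} {s t : ℝ} (hNs : -(N : ℝ) ≤ s)
    (hst : s ≤ t) (x : C(ℝ, ℝ)) :
    angleIncrement κ ρ f s t (clampPath N x) = angleIncrement κ ρ f s t x := by
  unfold angleIncrement
  rw [clampPath_apply_of_le hNs, clampPath_apply_of_le (hNs.trans hst)]
  congr 1
  refine intervalIntegral.integral_congr fun u hu ↦ ?_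
  rw [uIcc_of_le hst] at hu
  simp only [clampPath_apply_of_le (hNs.trans hu.1)]

/-- The martingale-problem increment of an extended path is the one-sided increment at the shifted
times. [folklore] -/
theorem angleIncrement_extendPath {ρ : ℝ} (f : ℝ → ℝ) {N : ℕ} {s t : ℝ} (hNs : -(N : ℝ) ≤ s)
    (hst : s ≤ t) (z : C(ℝ≥0, ℝ)) :
    angleIncrement κ ρ f s t (extendPath N z) =
      f (z (t + N).toNNReal) - f (z (s + N).toNNReal) -
        ∫ r in (((s + N).toNNReal : ℝ≥0) : ℝ)..(((t + N).toNNReal : ℝ≥0) : ℝ),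
          angleGenerator κ ρ f (z r.toNNReal) := by
  unfold angleIncrement
  simp only [extendPath_apply]
  have hs0 : 0 ≤ s + N := by linarith
  have ht0 : 0 ≤ t + N := by linarith
  rw [Real.coe_toNNReal _ hs0, Real.coe_toNNReal _ ht0,
    ← intervalIntegral.integral_comp_add_right (fun r ↦ angleGenerator κ ρ f (z r.toNNReal)) (N : ℝ)]

end PathOps

/-! ### The cylinder π-system of the coordinate filtration -/

section Cylinders

/-- The coordinate filtration at time `s` is generated by the evaluations at times `≤ s`.
[folklore] -/
theorem angleFiltration_eq_iSup (s : ℝ) :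
    (angleFiltration s : MeasurableSpace C(ℝ, ℝ)) =
      ⨆ j ∈ Iic s, (MeasurableSpace.comap (fun x : C(ℝ, ℝ) ↦ x j) inferInstance) := rfl

/-- **The cylinder π-system generating `ℱ_s`.** [folklore] -/
theorem angleFiltration_eq_generateFrom_cylinders (s : ℝ) :
    (angleFiltration s : MeasurableSpace C(ℝ, ℝ)) =
      MeasurableSpace.generateFrom
        (piiUnionInter (fun j ↦ {A | MeasurableSet[
          (MeasurableSpace.comap (fun x : C(ℝ, ℝ) ↦ x j) inferInstance)] A}) (Iic s)) := by
  rw [angleFiltration_eq_iSup]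
  exact (generateFrom_piiUnionInter_measurableSet
    (fun j ↦ (MeasurableSpace.comap (fun x : C(ℝ, ℝ) ↦ x j) inferInstance)) (Iic s)).symm

/-- The cylinders form a π-system. [folklore] -/
theorem isPiSystem_cylinders (s : ℝ) :
    IsPiSystem (piiUnionInter (fun j ↦ {A : Set C(ℝ, ℝ) | MeasurableSet[
      (MeasurableSpace.comap (fun x : C(ℝ, ℝ) ↦ x j) inferInstance)] A}) (Iic s)) :=
  isPiSystem_piiUnionInter _ (fun j ↦ @MeasurableSpace.isPiSystem_measurableSet _
    ((MeasurableSpace.comap (fun x : C(ℝ, ℝ) ↦ x j) inferInstance))) _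

/-- A cylinder of `ℱ_s` is a finite intersection of coordinate events at times `≤ s`. [folklore] -/
theorem exists_eq_biInter_of_mem_cylinders {s : ℝ} {A : Set C(ℝ, ℝ)}
    (hA : A ∈ piiUnionInter (fun j ↦ {A : Set C(ℝ, ℝ) | MeasurableSet[
      (MeasurableSpace.comap (fun x : C(ℝ, ℝ) ↦ x j) inferInstance)] A}) (Iic s)) :
    ∃ (F : Finset ℝ) (B : ℝ → Set ℝ), (∀ j ∈ F, j ≤ s) ∧ (∀ j ∈ F, MeasurableSet (B j)) ∧
      A = ⋂ j ∈ F, (fun x : C(ℝ, ℝ) ↦ x j) ⁻¹' B j := by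
  obtain ⟨F, hF, g, hg, rfl⟩ := hA
  have hg' : ∀ j ∈ F, ∃ B : Set ℝ, MeasurableSet B ∧ (fun x : C(ℝ, ℝ) ↦ x j) ⁻¹' B = g j :=
    fun j hj ↦ MeasurableSpace.measurableSet_comap.1 (hg j hj)
  choose! B hBm hBeq using hg'
  refine ⟨F, B, fun j hj ↦ hF hj, hBm, ?_⟩
  refine iInter₂_congr fun j hj ↦ ?_
  rw [hBeq j hj]

/-- The indicator of a coordinate cylinder is the product of the coordinate indicators. [folklore] -/
theorem indicator_biInter_eval (F : Finset ℝ) (B : ℝ → Set ℝ) (g : C(ℝ, ℝ) → ℝ) (x : C(ℝ, ℝ)) :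
    (⋂ j ∈ F, (fun x : C(ℝ, ℝ) ↦ x j) ⁻¹' B j).indicator g x =
      (∏ j ∈ F, (B j).indicator (1 : ℝ → ℝ) (x j)) * g x := by
  by_cases hx : x ∈ ⋂ j ∈ F, (fun x : C(ℝ, ℝ) ↦ x j) ⁻¹' B j
  · rw [indicator_of_mem hx, Finset.prod_eq_one, one_mul]
    intro j hj
    have : x j ∈ B j := by
      have := mem_iInter₂.1 hx j hj; simpa using this
    simp [this]
  · rw [indicator_of_notMem hx]
    have : ∃ j, j ∈ F ∧ x j ∉ B j := by
      simpa only [mem_iInter, mem_preimage, not_forall, exists_prop] using hx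
    obtain ⟨j, hj, hxj⟩ := this
    rw [Finset.prod_eq_zero hj (by simp [hxj]), zero_mul]

end Cylinders

/-! ### Vanishing of the martingale-problem increment against past cylinders -/

section Clamp

variable {μ : Measure ℝ} {P : Measure C(ℝ, ℝ)}

/-- **The increment integrated against a past coordinate cylinder vanishes.** If the clamps of `P`
are the extensions of the flow law of `μ` (`hclamp`), `μ` is carried by `(0, 2π)` and `κ ≤ 4`,
then for `f ∈ C²_c(0, 2π)`, `s ≤ t`, finitely many times `j ≤ s` and Borel `B_j`,
`∫ ∏ⱼ 𝟙_{B_j}(x_j) · N^f_{s,t}(x) dP = 0`. (Transport to the flow law along `clampPath N₀`,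
`extendPath N₀` for a level `-N₀` below all the times, then
`integral_prod_indicator_mul_angleIncrement_flowLaw_eq_zero`.)
[cite: KaratzasShreve1988, Ch. 5 §4.B] -/
theorem integral_prod_indicator_mul_angleIncrement_eq_zero (hκ : κ ≤ 4) [IsProbabilityMeasure μ]
    (hμ : ∀ᵐ θ ∂μ, θ ∈ Ioo 0 (2 * Real.pi)) [IsProbabilityMeasure P]
    (hclamp : ∀ N : ℕ, P.map (clampPath N) = (flowLaw κ μ).map (extendPath N))
    {f : ℝ → ℝ} (hf : ContDiff ℝ 2 f) (hfc : HasCompactSupport f)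
    (hsupp : tsupport f ⊆ Ioo 0 (2 * Real.pi)) {s t : ℝ} (hst : s ≤ t) (F : Finset ℝ)
    (hF : ∀ j ∈ F, j ≤ s) {B : ℝ → Set ℝ} (hB : ∀ j ∈ F, MeasurableSet (B j)) :
    ∫ x, (∏ j ∈ F, (B j).indicator (1 : ℝ → ℝ) (x j)) * angleIncrement κ 0 f s t x ∂P = 0 := by
  classical
  -- a clamp level below `s` and all the times of `F`
  obtain ⟨N₀, hN₀s, hN₀F⟩ : ∃ N₀ : ℕ, -(N₀ : ℝ) ≤ s ∧ ∀ j ∈ F, -(N₀ : ℝ) ≤ j := by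
    obtain ⟨N, hN⟩ := exists_nat_ge (|s| + ∑ j ∈ F, |j|)
    refine ⟨N, ?_, fun j hj ↦ ?_⟩
    · have h0 : 0 ≤ ∑ j ∈ F, |j| := Finset.sum_nonneg fun j _ ↦ abs_nonneg j
      linarith [neg_abs_le s]
    · have h1 : |j| ≤ ∑ i ∈ F, |i| := Finset.single_le_sum (fun i _ ↦ abs_nonneg i) hj
      linarith [neg_abs_le j, abs_nonneg s]
  -- the integrand and its invariance under the clamp
  set Φ : C(ℝ, ℝ) → ℝ := fun x ↦ (∏ j ∈ F, (B j).indicator (1 : ℝ → ℝ) (x j)) *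
    angleIncrement κ 0 f s t x with hΦ
  have hΦm : Measurable Φ :=
    (Finset.measurable_prod _ fun j hj ↦
      (measurable_const.indicator (hB j hj)).comp (continuous_eval_const j).measurable).mul
      (measurable_angleIncrement hf hsupp s t)
  have hΦclamp : ∀ x, Φ (clampPath N₀ x) = Φ x := fun x ↦ by
    simp only [hΦ]
    rw [angleIncrement_clampPath f hN₀s hst x]
    congr 1
    refine Finset.prod_congr rfl fun j hj ↦ ?_
    rw [clampPath_apply_of_le (hN₀F j hj)]
  -- transport to the flow law
  have e1 : ∫ x, Φ x ∂P = ∫ z, Φ (extendPath N₀ z) ∂(flowLaw κ μ) := by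
    calc ∫ x, Φ x ∂P = ∫ x, Φ (clampPath N₀ x) ∂P := by simp_rw [hΦclamp]
      _ = ∫ y, Φ y ∂(P.map (clampPath N₀)) :=
          (integral_map (measurable_clampPath N₀).aemeasurable hΦm.aestronglyMeasurable).symm
      _ = ∫ y, Φ y ∂((flowLaw κ μ).map (extendPath N₀)) := by rw [hclamp N₀]
      _ = ∫ z, Φ (extendPath N₀ z) ∂(flowLaw κ μ) :=
          integral_map (measurable_extendPath N₀).aemeasurable hΦm.aestronglyMeasurable
  change ∫ x, Φ x ∂P = 0
  rw [e1]
  -- the one-sided form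
  set s' : ℝ≥0 := (s + N₀).toNNReal with hs'
  set t' : ℝ≥0 := (t + N₀).toNNReal with ht'
  have hst' : s' ≤ t' := Real.toNNReal_le_toNNReal (by linarith)
  set v : ℝ → ℝ≥0 := fun j ↦ (j + N₀).toNNReal with hv
  have hvs : ∀ j ∈ F, v j ≤ s' := fun j hj ↦ Real.toNNReal_le_toNNReal (by linarith [hF j hj])
  have e2 : ∀ z : C(ℝ≥0, ℝ), Φ (extendPath N₀ z) =
      (∏ j ∈ F, (B j).indicator (1 : ℝ → ℝ) (z (v j))) *
        (f (z t') - f (z s') - ∫ r in (s' : ℝ)..t', angleGenerator κ 0 f (z r.toNNReal)) := by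
    intro z
    simp only [hΦ]
    rw [angleIncrement_extendPath f hN₀s hst z]
    rfl
  simp_rw [e2]
  exact integral_prod_indicator_mul_angleIncrement_flowLaw_eq_zero hκ hμ hf hfc hsupp hst' F hvs hB

/-- **The martingale-problem clause**: under the clamp identities, `E[N^f_{s,t} | ℱ_s] = 0` for
every `f ∈ C²_c(0, 2π)` and `s ≤ t` (Dynkin's π-λ theorem over the cylinders of `ℱ_s`, and
`integral_prod_indicator_mul_angleIncrement_eq_zero`). [cite: KaratzasShreve1988, Ch. 5 §4.B] -/
theorem condExp_angleIncrement_eq_zero_of_clamp (hκ : κ ≤ 4) [IsProbabilityMeasure μ]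
    (hμ : ∀ᵐ θ ∂μ, θ ∈ Ioo 0 (2 * Real.pi)) [IsProbabilityMeasure P]
    (hclamp : ∀ N : ℕ, P.map (clampPath N) = (flowLaw κ μ).map (extendPath N))
    {f : ℝ → ℝ} (hf : ContDiff ℝ 2 f) (hfc : HasCompactSupport f)
    (hsupp : tsupport f ⊆ Ioo 0 (2 * Real.pi)) {s t : ℝ} (hst : s ≤ t) :
    P[angleIncrement κ 0 f s t | angleFiltration s] =ᵐ[P] 0 := by
  classical
  have hint : Integrable (angleIncrement κ 0 f s t) P := integrable_angleIncrement hf hfc hsupp s t P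
  rw [condExp_ae_eq_zero_iff_forall_setIntegral_eq_zero (angleFiltration.le s) hint]
  -- the whole-space integral (empty cylinder)
  have huniv : ∫ x, angleIncrement κ 0 f s t x ∂P = 0 := by
    have h := integral_prod_indicator_mul_angleIncrement_eq_zero hκ hμ hclamp hf hfc hsupp hst ∅
      (fun j hj ↦ absurd hj (Finset.notMem_empty j)) (B := fun _ ↦ univ)
      (fun j hj ↦ absurd hj (Finset.notMem_empty j))
    simpa using h
  intro A hA
  refine MeasurableSpace.induction_on_inter (m := (angleFiltration s : MeasurableSpace C(ℝ, ℝ)))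
    (C := fun A _ ↦ ∫ x in A, angleIncrement κ 0 f s t x ∂P = 0)
    (angleFiltration_eq_generateFrom_cylinders s) (isPiSystem_cylinders s) ?_ ?_ ?_ ?_ A hA
  · simp
  · intro A hAc
    obtain ⟨F, B, hF, hB, rfl⟩ := exists_eq_biInter_of_mem_cylinders hAc
    have hAm : MeasurableSet (⋂ j ∈ F, (fun x : C(ℝ, ℝ) ↦ x j) ⁻¹' B j) :=
      Finset.measurableSet_biInter F fun j hj ↦ (continuous_eval_const j).measurable (hB j hj)
    rw [← integral_indicator hAm]
    simp_rw [indicator_biInter_eval F B]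
    exact integral_prod_indicator_mul_angleIncrement_eq_zero hκ hμ hclamp hf hfc hsupp hst F hF hB
  · intro A hAm hA0
    have hAm' : MeasurableSet A := angleFiltration.le s _ hAm
    have h := integral_add_compl hAm' hint
    rw [hA0, huniv, zero_add] at h
    exact h
  · intro g hdisj hgm hg0
    rw [integral_iUnion (fun i ↦ angleFiltration.le s _ (hgm i)) hdisj hint.integrableOn]
    simp [hg0]

end Clamp

/-! ### The stationary angle law from the clamp identities -/

section Assembly

variable {μ : Measure ℝ} {P : Measure C(ℝ, ℝ)}

/-- **All paths lie in `(0, 2π)` at all times**, a.s., when the clamps of `P` are extensions of the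
flow law. [folklore] -/
theorem ae_forall_mem_Ioo_of_clamp [IsProbabilityMeasure P]
    (hclamp : ∀ N : ℕ, P.map (clampPath N) = (flowLaw κ μ).map (extendPath N)) :
    ∀ᵐ x ∂P, ∀ t : ℝ, x t ∈ Ioo 0 (2 * Real.pi) := by
  have hN : ∀ N : ℕ, ∀ᵐ x ∂P, ∀ t : ℝ, -(N : ℝ) ≤ t → x t ∈ Ioo 0 (2 * Real.pi) := by
    intro N
    have h1 : ∀ᵐ y ∂((flowLaw κ μ).map (extendPath N)), ∀ t : ℝ, y t ∈ Ioo 0 (2 * Real.pi) := by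
      refine (ae_map_iff (measurable_extendPath N).aemeasurable measurableSet_forall_mem_Ioo).2 ?_
      filter_upwards [ae_flowLaw_forall_mem_Ioo (κ := κ) μ] with z hz t
      rw [extendPath_apply]
      exact hz _
    rw [← hclamp N] at h1
    filter_upwards [ae_of_ae_map (measurable_clampPath N).aemeasurable h1] with x hx t ht
    have := hx t
    rwa [clampPath_apply_of_le ht] at this
  rw [← ae_all_iff] at hN
  filter_upwards [hN] with x hx t
  exact hx ⌈|t|⌉₊ t (neg_ceil_abs_le t)

/-- **A shift-invariant law whose clamps are extensions of the flow law of a measure on `(0, 2π)`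
is a stationary SLE_κ(0) angle law** (`κ ≤ 4`). This packages the three clauses of
`IsStationaryAngleLaw`; it serves both the existence half (two-sided extension of the stationary
flow law) and the uniqueness half of Miller–Sheffield (2013), Prop. 2.1.
[cite: MillerSheffield2013, Prop. 2.1] -/
theorem isStationaryAngleLaw_of_clamp (hκ : κ ≤ 4) [IsProbabilityMeasure μ]
    (hμ : ∀ᵐ θ ∂μ, θ ∈ Ioo 0 (2 * Real.pi)) [IsProbabilityMeasure P]
    (hclamp : ∀ N : ℕ, P.map (clampPath N) = (flowLaw κ μ).map (extendPath N))
    (hshift : ∀ s : ℝ, P.map (twoShift s) = P) : IsStationaryAngleLaw κ 0 P := by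
  refine ⟨inferInstance, ae_forall_mem_Ioo_of_clamp hclamp, fun s ↦ ?_, ?_⟩
  · rw [timeShift_eq_twoShift]; exact hshift s
  · intro f hf hfc hsupp s t hst
    exact ⟨integrable_angleIncrement hf hfc hsupp s t P,
      condExp_angleIncrement_eq_zero_of_clamp hκ hμ hclamp hf hfc hsupp hst⟩

/-- **Existence of the stationary SLE_κ(0) angle law for `0 < κ ≤ 4`**, with its clamp
identities: the two-sided extension of the stationary flow law of the invariant probability measure
`μ` of the SLE_κ radial Bessel kernels. [cite: MillerSheffield2013, Prop. 2.1] -/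
theorem exists_isStationaryAngleLaw_with_clamp (hκ0 : 0 < κ) (hκ : κ ≤ 4) :
    ∃ (μ : Measure ℝ) (P : Measure C(ℝ, ℝ)), IsProbabilityMeasure μ ∧
      (∀ᵐ θ ∂μ, θ ∈ Ioo 0 (2 * Real.pi)) ∧ (∀ t, μ.bind (sleKernel κ t) = μ) ∧
      IsProbabilityMeasure P ∧
      (∀ N : ℕ, P.map (clampPath N) = (flowLaw κ μ).map (extendPath N)) ∧
      (∀ s : ℝ, P.map (twoShift s) = P) ∧ IsStationaryAngleLaw κ 0 P := by
  obtain ⟨μ, hμ, hμIoo, hinv⟩ := exists_invariant_sleKernel hκ0 hκ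
  have hstat : ∀ h : ℝ≥0, (flowLaw κ μ).map (shiftPath h) = flowLaw κ μ :=
    map_shiftPath_flowLaw_of_forall hκ hμIoo hinv
  obtain ⟨P, hP, hclamp, hshift⟩ := exists_twoSided_extension (flowLaw κ μ) hstat
  exact ⟨μ, P, hμ, hμIoo, hinv, hP, hclamp, hshift,
    isStationaryAngleLaw_of_clamp hκ hμIoo hclamp hshift⟩

/-- **Existence of the stationary SLE_κ(0) angle law** (Miller–Sheffield (2013), Prop. 2.1,
existence half, reduced case `ρ = 0`, `0 < κ ≤ 4`): there is a probability measure on two-sided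
angle paths which stays in `(0, 2π)`, is shift invariant, and solves the martingale problem of
`L₀ = (κ/2)∂² + cot(·/2)∂`. [cite: MillerSheffield2013, Prop. 2.1] -/
theorem exists_isStationaryAngleLaw_rho_zero (hκ0 : 0 < κ) (hκ : κ ≤ 4) :
    ∃ P : Measure C(ℝ, ℝ), IsStationaryAngleLaw κ 0 P := by
  obtain ⟨-, P, -, -, -, -, -, -, hP⟩ := exists_isStationaryAngleLaw_with_clamp hκ0 hκ
  exact ⟨P, hP⟩

end Assembly

end Literature.Probability.RandomPlanarGeometry
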